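import Literature.Computability.Complexity.StackFFTDriverSteps
import HarnessLib

/-!
# The recursion driver of the fast negacyclic multiplier, II: the machine and its cost

Literature / complexity toolkit, continuing `StackFFTDriverSteps.lean`.  The two while-loops
and the whole multiplier:

* `kdSet` (the descent test `KD := 1^{k ∸ 3}`), `descBody`, `descLoop` (a stream loop on `KD`),
  `ascLoop` (a stream loop on the schedule `SCHED`), **`negMulMachine`**;
* **`runs_descLoop`** (invariant: the remaining depths are `NegFFT.ditems k B`, with the leaf
  data `kfin / dAll / schedFin / histFin` as ghost constants), **`runs_ascLoop`** (invariant: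
  `NegFFT.AscWF` of the remaining depths, the final `ascAll` as ghost constant), and
  **`runs_negMulMachine`**: for `N > 1`, from the exponent `k` and two batches of `B` valid
  blocks of length `2^k` the machine ends with `RR = encBlocks (zipWith (negMulRec N k) Fb Gb)`
  (the products in `(ℤ/N)[x]/(x^{2^k}+1)` by `NegFFT.negMulRec_spec`), everything else restored,
  within `negMulMachineCost n k B` steps;
* the cost in closed form: the data doubles per depth and there are `≤ log₂(2k+1)` depths
  (`NegFFT.ditems_sum`, `NegFFT.two_pow_depth_le`, `NegFFT.ditems_weight_le`,
  `NegFFT.leaf_weight_le`), every step is linear in its depth's data (`descStepCost_le`,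
  `ascStepCost_le`, `baseAllCost_le`, …), whence **`negMulMachineCost_le`**:
  `negMulMachineCost n k B ≤ 10⁵ · (k+1)² · (B+1) · 2^k · (n+1)³` — quasi-linear in the data
  size `B · 2^k` (entries of `≤ n` bits).

## References

* J. von zur Gathen, J. Gerhard, *Modern Computer Algebra*, 3rd ed., CUP 2013, §8.3 Alg. 8.20,
  Thm. 8.23 (the `O(n log n log log n)` operation count of Schönhage–Strassen).
* A. Schönhage, V. Strassen, Schnelle Multiplikation großer Zahlen, *Computing* 7 (1971)
  281–292. (Folklore material, fully proved here.)
-/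

namespace Literature.Computability.Complexity

open _root_.Computability SProg

namespace Com

variable {β : Type} [DecidableEq β] (q : GReg ↪ β)

/-! ### The loops and the multiplier -/

/-- Set the descent test `KD := 1^{k ∸ 3}` from `KN`. [folklore] -/
def kdSet : NS β := NS.ofList [.toUnary (q .KD) (q .KN), .drop (q .KD), .drop (q .KD), .drop (q .KD)]

/-- The body of the descent loop: clear the test, descend, reset the test. [folklore] -/
def descBody : Com (EReg ⊕ β) := (NS.op (.clear (q .KD)) : NS β).com ;; (descStep q ;; (kdSet q).com)

/-- The descent loop: while `k > 3`, descend. [folklore] -/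
def descLoop : Com (EReg ⊕ β) := (kdSet q).com ;; streamLoop (Sum.inr (q .KD)) (Sum.inr (q .W0)) (descBody q)

/-- The ascent loop: while the schedule is nonempty, ascend. [folklore] -/
def ascLoop : Com (EReg ⊕ β) := streamLoop (Sum.inr (q .SCHED)) (Sum.inr (q .W0)) (ascStep q)

/-- **The breadth-first Schönhage–Strassen / Cantor–Kaltofen negacyclic multiplier on the stack
machine**: descend to blocks of length `≤ 8`, multiply them by the schoolbook multiplier, ascend.
[folklore] -/
def negMulMachine : Com (EReg ⊕ β) := descLoop q ;; (baseAll q ;; ascLoop q)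

/-- The driver record during the descent loop. [folklore] -/
def GSlots.dframe (w : GSlots) (k : ℕ) (Fb Gb : List (List ℕ)) (S H : List (List Bool)) : GSlots :=
  { w with kn := encodeNat k, kd := List.replicate (k - 3) true, bf := encBlocks Fb, bg := encBlocks Gb, sched := encList S, hist := encList H }

/-- The driver record during the ascent loop. [folklore] -/
def GSlots.aframe (w : GSlots) (l : List (ℕ × ℕ)) (M : List (List ℕ)) : GSlots :=
  { w with kn := [], kd := [], bf := [], bg := [], rr := encBlocks M, sched := encList (l.map fun p => encodeNat p.1), hist := encList (NegFFT.aHist l) }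

/-- A clean driver record: every parameter and scratch register empty. [folklore] -/
def GSlots.Clean (w : GSlots) : Prop :=
  w.kd = [] ∧ w.ar = [] ∧ w.lvn = [] ∧ w.lvu = [] ∧ w.mreg = [] ∧ w.treg = [] ∧ w.hn = [] ∧ w.m2 = [] ∧ w.m4 = [] ∧ w.len = [] ∧
  w.tw2 = [] ∧ w.tws = [] ∧ w.tw3 = [] ∧ w.tmph = [] ∧ w.out = [] ∧ w.twout = [] ∧ w.cc = [] ∧ w.w0 = [] ∧ w.rr = [] ∧
  w.fz = ⟨[], [], [], [], [], [], [], [], [], [], [], [], [], [], [], []⟩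

/-- Cost of the descent-loop body at depth `(k, B)`. [folklore] -/
def descBodyCost (n : ℕ) (p : ℕ × ℕ) : ℕ := descStepCost n p.1 p.2 + 51 * (n + 1) ^ 3

/-- **The descent-loop body.** [folklore] -/
theorem runs_descBody {N k n : ℕ} (hN : 0 < N) (hn : (encodeNat N).length + 1 ≤ n) (hkn : k + 4 ≤ n) (hk : 3 < k)
    (T : Regs β) (hI : DrvInv q N T) (w : GSlots) (hw : w.Clean) {Fb Gb : List (List ℕ)}
    (hFb : ∀ b ∈ Fb, NegFFT.BlockOK N (2 ^ k) b) (hGb : ∀ b ∈ Gb, NegFFT.BlockOK N (2 ^ k) b) (hBG : Gb.length = Fb.length) (S H : List (List Bool)) :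
    Runs (descBody q) (base (gSt q T (w.dframe k Fb Gb S H)))
      (base (gSt q T (w.dframe ((k + 1) / 2 + 1) (NegFFT.descOne N k Fb) (NegFFT.descOne N k Gb) (encodeNat k :: S) (NegFFT.twEnc (k, Fb.length) ++ H))))
      (descBodyCost n (k, Fb.length)) := by
  obtain ⟨hkd, har, hlvn, hlvu, hmreg, htreg, hhn, hm2, hm4, hlen, htw2, htws, htw3, htmph, hout, htwout, hcc, hw0, hrr, hfz⟩ := hw
  set c := (n + 1) ^ 3 with hc3
  set k' := (k + 1) / 2 + 1 with hk'
  have hlk : (encodeNat k).length ≤ n := (length_encodeNat_le_succ (le_two_pow_self k)).trans (by omega)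
  have hlk' : (encodeNat k').length ≤ n := (length_encodeNat_le_succ (le_two_pow_self k')).trans (by omega)
  let v0 : GSlots := w.dframe k Fb Gb S H
  let v1 : GSlots := { v0 with kd := [] }
  let v2 : GSlots := v1.descEnd N k Fb Gb
  have h1 : Runs (NS.op (.clear (q .KD)) : NS β).com (base (gSt q T v0)) (base (gSt q T v1)) (3 * c) :=
    NS.runs_of_eq (N := n) _ _ (by simp [NOp.ok, v0, GSlots.dframe]; omega) (by simp [v0, v1]) (by simp [hc3])
  have h2 : Runs (descStep q) (base (gSt q T v1)) (base (gSt q T v2)) (descStepCost n k Fb.length) :=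
    runs_descStep q hN hn hkn T hI v1 hFb hGb hBG (by simp [v1, v0, GSlots.dframe]) (by simp [v1, v0, GSlots.dframe]) (by simp [v1, v0, GSlots.dframe])
      rfl (by simp [v1, v0, GSlots.dframe, har]) (by simp [v1, v0, GSlots.dframe, hlvn]) (by simp [v1, v0, GSlots.dframe, hlvu])
      (by simp [v1, v0, GSlots.dframe, hmreg]) (by simp [v1, v0, GSlots.dframe, htreg]) (by simp [v1, v0, GSlots.dframe, hhn])
      (by simp [v1, v0, GSlots.dframe, hm2]) (by simp [v1, v0, GSlots.dframe, hm4]) (by simp [v1, v0, GSlots.dframe, hlen])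
      (by simp [v1, v0, GSlots.dframe, htw2]) (by simp [v1, v0, GSlots.dframe, htws]) (by simp [v1, v0, GSlots.dframe, htw3])
      (by simp [v1, v0, GSlots.dframe, htmph]) (by simp [v1, v0, GSlots.dframe, hout]) (by simp [v1, v0, GSlots.dframe, htwout])
      (by simp [v1, v0, GSlots.dframe, hfz])
  -- coded lists concatenate (the library copy lives in a sideways module, `MetaComplexity/FregeTranslation.lean`)
  have encList_append : ∀ A B : List (List Bool), encList (A ++ B) = encList A ++ encList B := by
    intro A B
    induction A with
    | nil => rfl
    | cons a A ih => rw [List.cons_append, encList_cons, encList_cons, ih, boolPair, boolPair]; simp [List.append_assoc]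
  have h3 : Runs (kdSet q).com (base (gSt q T v2))
      (base (gSt q T (w.dframe k' (NegFFT.descOne N k Fb) (NegFFT.descOne N k Gb) (encodeNat k :: S) (NegFFT.twEnc (k, Fb.length) ++ H)))) (48 * c) := by
    refine NS.runs_of_eq (N := n) _ _ ?_ ?_ (by simp [hc3, kdSet])
    · simp only [kdSet, NS.ofList, NS.ok, NOp.ok, gSt_KD, gSt_KN, v2, v1, v0, GSlots.dframe, GSlots.descEnd,
        bitsToNat_encodeNat, ← hk']
      exact ⟨⟨trivial, hlk', by omega⟩, trivial, trivial, trivial, trivial⟩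
    · simp [kdSet, v2, v1, v0, GSlots.dframe, GSlots.descEnd, ← hk', NegFFT.twEnc, ← dbl_append_encList, encList_append, List.tail_replicate,
        Nat.sub_sub]
  refine (h1.seq (h2.seq h3)).of_eq rfl ?_
  simp only [descBodyCost]; omega

/-- Cost of the descent loop from `(k, B)`. [folklore] -/
def descLoopCost (n k B : ℕ) : ℕ :=
  48 * (n + 1) ^ 3 + (((NegFFT.ditems k B).map (descBodyCost n)).sum + 6 * (NegFFT.ditems k B).length + 4)

/-- **The descent loop**: from exponent `k` down to the leaf exponent `kfin k`, the batches become
the leaf batches `dAll`, the schedule `schedFin` and the history `histFin`. [folklore] -/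
theorem runs_descLoop {N k n : ℕ} (hN : 0 < N) (hn : (encodeNat N).length + 1 ≤ n) (hkn : k + 4 ≤ n)
    (T : Regs β) (hI : DrvInv q N T) (w : GSlots) (hw : w.Clean) {Fb Gb : List (List ℕ)}
    (hFb : ∀ b ∈ Fb, NegFFT.BlockOK N (2 ^ k) b) (hGb : ∀ b ∈ Gb, NegFFT.BlockOK N (2 ^ k) b) (hBG : Gb.length = Fb.length) (S H : List (List Bool)) :
    Runs (descLoop q) (base (gSt q T { w with kn := encodeNat k, bf := encBlocks Fb, bg := encBlocks Gb, sched := encList S, hist := encList H }))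
      (base (gSt q T (w.dframe (NegFFT.kfin k) (NegFFT.dAll N k Fb) (NegFFT.dAll N k Gb) (NegFFT.schedFin k S) (NegFFT.histFin k Fb.length H))))
      (descLoopCost n k Fb.length) := by
  have hgq : ∀ {i j : GReg}, i ≠ j → q i ≠ q j := fun h => gq_ne q h
  obtain ⟨hkd, har, hlvn, hlvu, hmreg, htreg, hhn, hm2, hm4, hlen, htw2, htws, htw3, htmph, hout, htwout, hcc, hw0, hrr, hfz⟩ := id hw
  set c := (n + 1) ^ 3 with hc3
  have hlk : (encodeNat k).length ≤ n := (length_encodeNat_le_succ (le_two_pow_self k)).trans (by omega)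
  -- set the test
  have h0 : Runs (kdSet q).com (base (gSt q T { w with kn := encodeNat k, bf := encBlocks Fb, bg := encBlocks Gb, sched := encList S, hist := encList H }))
      (base (gSt q T (w.dframe k Fb Gb S H))) (48 * c) := by
    refine NS.runs_of_eq (N := n) _ _ ?_ ?_ (by simp [hc3, kdSet])
    · simp only [kdSet, NS.ofList, NS.ok, NOp.ok, gSt_KD, gSt_KN, hkd, bitsToNat_encodeNat]
      exact ⟨⟨trivial, hlk, by omega⟩, trivial, trivial, trivial, trivial⟩
    · simp [kdSet, GSlots.dframe, hkd, List.tail_replicate, Nat.sub_sub]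
  -- the loop
  have hloop := runs_streamLoop (L := (Sum.inr (q .KD) : EReg ⊕ β)) (w := Sum.inr (q .W0)) (by simp [hgq]) (body := descBody q)
    NegFFT.kdCode rfl (fun a l => by simp [NegFFT.kdCode])
    (fun l R => ∃ (k₁ : ℕ) (Fb₁ Gb₁ : List (List ℕ)) (S₁ H₁ : List (List Bool)), l = NegFFT.ditems k₁ Fb₁.length ∧ Gb₁.length = Fb₁.length ∧
      (∀ b ∈ Fb₁, NegFFT.BlockOK N (2 ^ k₁) b) ∧ (∀ b ∈ Gb₁, NegFFT.BlockOK N (2 ^ k₁) b) ∧ k₁ + 4 ≤ n ∧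
      R = base (gSt q T (w.dframe k₁ Fb₁ Gb₁ S₁ H₁)) ∧ NegFFT.kfin k₁ = NegFFT.kfin k ∧ NegFFT.dAll N k₁ Fb₁ = NegFFT.dAll N k Fb ∧
      NegFFT.dAll N k₁ Gb₁ = NegFFT.dAll N k Gb ∧ NegFFT.schedFin k₁ S₁ = NegFFT.schedFin k S ∧ NegFFT.histFin k₁ Fb₁.length H₁ = NegFFT.histFin k Fb.length H)
    (descBodyCost n)
    (by
      rintro a l R ⟨k₁, Fb₁, Gb₁, S₁, H₁, hl, hBG₁, hFb₁, hGb₁, hkn₁, rfl, g1, g2, g3, g4, g5⟩ - -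
      have hk₁ : 3 < k₁ := by
        by_contra h'; rw [NegFFT.ditems_of_le (by omega)] at hl; simp at hl
      rw [NegFFT.ditems_of_gt hk₁] at hl
      obtain ⟨rfl, rfl⟩ := List.cons_eq_cons.1 hl
      obtain ⟨hlF, hvF⟩ := NegFFT.descOne_facts N hN k₁ Fb₁ hFb₁
      obtain ⟨hlG, hvG⟩ := NegFFT.descOne_facts N hN k₁ Gb₁ hGb₁
      refine ⟨_, runs_descBody q hN hn hkn₁ hk₁ T hI w hw hFb₁ hGb₁ hBG₁ S₁ H₁, ?_, ?_, ?_⟩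
      · simp only [nst_inr, gSt_KD, GSlots.dframe]
        rw [← NegFFT.kdCode_ditems _ (Fb₁.length * 2 ^ (k₁ / 2))]
      · simp [GSlots.dframe, hw0]
      · refine ⟨(k₁ + 1) / 2 + 1, NegFFT.descOne N k₁ Fb₁, NegFFT.descOne N k₁ Gb₁, encodeNat k₁ :: S₁, NegFFT.twEnc (k₁, Fb₁.length) ++ H₁,
          by rw [hlF], by rw [hlF, hlG, hBG₁], fun b hb => ?_, fun b hb => ?_, by omega, rfl, ?_, ?_, ?_, ?_, ?_⟩
        · rw [← NegFFT.two_mul_two_pow_half]; exact hvF b hb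
        · rw [← NegFFT.two_mul_two_pow_half]; exact hvG b hb
        · rw [← g1, NegFFT.kfin_of_gt hk₁]
        · rw [← g2, NegFFT.dAll_of_gt N hk₁]
        · rw [← g3, NegFFT.dAll_of_gt N hk₁]
        · rw [← g4, NegFFT.schedFin_of_gt hk₁]
        · rw [← g5, NegFFT.histFin_of_gt hk₁, hlF])
    (NegFFT.ditems k Fb.length) (base (gSt q T (w.dframe k Fb Gb S H)))
    ⟨k, Fb, Gb, S, H, rfl, hBG, hFb, hGb, hkn, rfl, rfl, rfl, rfl, rfl, rfl⟩
    (by simp only [nst_inr, gSt_KD, GSlots.dframe]; rw [NegFFT.kdCode_ditems]) (by simp [GSlots.dframe, hw0])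
  obtain ⟨R', hL, -, -, k₁, Fb₁, Gb₁, S₁, H₁, hl, -, -, -, -, rfl, g1, g2, g3, g4, g5⟩ := hloop
  have hk₁ : k₁ ≤ 3 := by
    by_contra h'; rw [NegFFT.ditems_of_gt (by omega)] at hl; simp at hl
  rw [NegFFT.kfin_of_le hk₁] at g1
  rw [NegFFT.dAll_of_le N hk₁] at g2 g3
  rw [NegFFT.schedFin_of_le hk₁] at g4
  rw [NegFFT.histFin_of_le hk₁] at g5
  subst g1 g2 g3 g4 g5
  refine (h0.seq hL).of_eq rfl ?_
  unfold descLoopCost; omega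

/-- Cost of the ascent loop along the depths `l`. [folklore] -/
def ascLoopCost (n : ℕ) (l : List (ℕ × ℕ)) : ℕ := (l.map fun p => ascStepCost n p.1 p.2).sum + 6 * l.length + 4

/-- **The ascent loop**: along the well-formed depths `l` the leaf list `M` becomes `ascAll N l M`,
schedule and history are consumed. [folklore] -/
theorem runs_ascLoop {N n : ℕ} (hN1 : 1 < N) (hn : (encodeNat N).length + 1 ≤ n) (T : Regs β) (hI : DrvInv q N T)
    (hCI : T (q .CINV) = encodeNat (NegFFT.inv2N N)) (w : GSlots) (hw : w.Clean) (l : List (ℕ × ℕ)) (hl : ∀ p ∈ l, p.1 + 4 ≤ n)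
    {M : List (List ℕ)} (hM : NegFFT.AscWF N l M) :
    Runs (ascLoop q) (base (gSt q T (w.aframe l M))) (base (gSt q T (w.aframe [] (NegFFT.ascAll N l M)))) (ascLoopCost n l) := by
  have hgq : ∀ {i j : GReg}, i ≠ j → q i ≠ q j := fun h => gq_ne q h
  obtain ⟨hkd, har, hlvn, hlvu, hmreg, htreg, hhn, hm2, hm4, hlen, htw2, htws, htw3, htmph, hout, htwout, hcc, hw0, hrr, hfz⟩ := id hw
  have hN : 0 < N := by omega
  have hloop := runs_streamLoop (L := (Sum.inr (q .SCHED) : EReg ⊕ β)) (w := Sum.inr (q .W0)) (by simp [hgq]) (body := ascStep q)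
    (fun l : List (ℕ × ℕ) => encList (l.map fun p => encodeNat p.1)) rfl (fun a l => encList_cons_ne_nil _ _)
    (fun l' R => (∀ p ∈ l', p.1 + 4 ≤ n) ∧ ∃ M' : List (List ℕ), NegFFT.AscWF N l' M' ∧ R = base (gSt q T (w.aframe l' M')) ∧
      NegFFT.ascAll N l' M' = NegFFT.ascAll N l M)
    (fun p => ascStepCost n p.1 p.2)
    (by
      rintro ⟨k, B⟩ l' R ⟨hl', M', hwf, rfl, hg⟩ - -
      obtain ⟨hMl, hMv, hcont⟩ := NegFFT.ascWF_cons N hwf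
      have hkn : k + 4 ≤ n := hl' (k, B) (by simp)
      obtain ⟨hAl, hAv⟩ := NegFFT.ascOne_facts N k B M' hN hMl hMv
      have hr := runs_ascStep q hN1 hn hkn T hI hCI (w.aframe ((k, B) :: l') M') hMl hMv (S := l'.map fun p => encodeNat p.1) (H := NegFFT.aHist l')
        (by simp [GSlots.aframe]) (by simp [GSlots.aframe]) (by simp [GSlots.aframe, NegFFT.aHist, NegFFT.twEnc]) (by simp [GSlots.aframe])
        (by simp [GSlots.aframe]) (by simp [GSlots.aframe, har]) (by simp [GSlots.aframe, hlvn]) (by simp [GSlots.aframe, hlvu])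
        (by simp [GSlots.aframe, hmreg]) (by simp [GSlots.aframe, htreg]) (by simp [GSlots.aframe, hhn]) (by simp [GSlots.aframe, hm2])
        (by simp [GSlots.aframe, hm4]) (by simp [GSlots.aframe, hlen]) (by simp [GSlots.aframe, hcc]) (by simp [GSlots.aframe, hout])
        (by simp [GSlots.aframe, htwout]) (by simp [GSlots.aframe, hfz])
      have e : (w.aframe ((k, B) :: l') M').ascEnd N k M' (l'.map fun p => encodeNat p.1) (NegFFT.aHist l') = w.aframe l' (NegFFT.ascOne N k M') := by
        simp [GSlots.aframe, GSlots.ascEnd]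
      rw [e] at hr
      refine ⟨_, hr, by simp [GSlots.aframe], by simp [GSlots.aframe, hw0], fun p hp => hl' p (by simp [hp]), NegFFT.ascOne N k M',
        hcont _ hAl hAv, rfl, ?_⟩
      rw [← hg]; rfl)
    l (base (gSt q T (w.aframe l M))) ⟨hl, M, hM, rfl, rfl⟩ (by simp [GSlots.aframe]) (by simp [GSlots.aframe, hw0])
  obtain ⟨R', hL, -, -, -, M', -, rfl, hg⟩ := hloop
  rw [NegFFT.ascAll, List.foldl_nil] at hg
  subst hg
  exact hL.of_eq rfl le_rfl

/-- Cost of the multiplier on `B` pairs of blocks of length `2^k`. [folklore] -/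
def negMulMachineCost (n k B : ℕ) : ℕ :=
  descLoopCost n k B + baseAllCost n (NegFFT.kfin k) (NegFFT.Bfin k B) + ascLoopCost n (NegFFT.ditems k B).reverse

/-- **The negacyclic multiplier machine.** For `N > 1` (odd in the application), from a clean driver
state holding the exponent `k` in `KN` and two batches of `B` valid blocks of length `2^k` in `BF`,
`BG`, the machine ends with `RR = encBlocks (zipWith (negMulRec N k) Fb Gb)` — the products in
`(ℤ/N)[x]/(x^{2^k}+1)` by `negMulRec_spec` — and everything else restored, within
`negMulMachineCost n k B` steps. [folklore] -/
theorem runs_negMulMachine {N k n : ℕ} (hN1 : 1 < N) (hn : (encodeNat N).length + 1 ≤ n) (hkn : k + 4 ≤ n)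
    (T : Regs β) (hI : DrvInv q N T) (hCI : T (q .CINV) = encodeNat (NegFFT.inv2N N)) (w : GSlots) (hw : w.Clean)
    (hsched : w.sched = []) (hhist : w.hist = []) {Fb Gb : List (List ℕ)}
    (hFb : ∀ b ∈ Fb, NegFFT.BlockOK N (2 ^ k) b) (hGb : ∀ b ∈ Gb, NegFFT.BlockOK N (2 ^ k) b) (hBG : Gb.length = Fb.length) :
    Runs (negMulMachine q) (base (gSt q T { w with kn := encodeNat k, bf := encBlocks Fb, bg := encBlocks Gb }))
      (base (gSt q T { w with kn := [], bf := [], bg := [], rr := encBlocks (List.zipWith (NegFFT.negMulRec N k) Fb Gb) }))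
      (negMulMachineCost n k Fb.length) := by
  obtain ⟨hkd, har, hlvn, hlvu, hmreg, htreg, hhn, hm2, hm4, hlen, htw2, htws, htw3, htmph, hout, htwout, hcc, hw0, hrr, hfz⟩ := id hw
  have hN : 0 < N := by omega
  set kf := NegFFT.kfin k with hkf
  have hkf3 : kf ≤ 3 := NegFFT.kfin_le_three k
  have hkfk : kf ≤ k := NegFFT.kfin_le_self k
  -- descent
  have hD := runs_descLoop q hN hn hkn T hI w hw hFb hGb hBG [] []
  have e0 : ({ w with kn := encodeNat k, bf := encBlocks Fb, bg := encBlocks Gb, sched := encList [], hist := encList [] } : GSlots) =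
      { w with kn := encodeNat k, bf := encBlocks Fb, bg := encBlocks Gb } := by simp [hsched, hhist]
  rw [e0] at hD
  -- leaves
  obtain ⟨hlL, hvL⟩ := NegFFT.leaf_facts N hN k hFb hGb hBG
  obtain ⟨hlF, hvF⟩ := NegFFT.dAll_facts N hN k Fb hFb
  obtain ⟨hlG, hvG⟩ := NegFFT.dAll_facts N hN k Gb hGb
  have hB := runs_baseAll q hn (show kf + 2 ≤ n by omega) T hI (w.dframe kf (NegFFT.dAll N k Fb) (NegFFT.dAll N k Gb) (NegFFT.schedFin k []) (NegFFT.histFin k Fb.length []))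
    hvF hvG (by rw [hlF, hlG, hBG]) (by simp [GSlots.dframe, hkf]) (by simp [GSlots.dframe]) (by simp [GSlots.dframe]) (by simp [GSlots.dframe, hrr])
    (by simp [GSlots.dframe, hlen]) (by simp [GSlots.dframe, hcc]) (by simp [GSlots.dframe, hout]) (by simp [GSlots.dframe, hfz])
  -- ascent
  set L := (NegFFT.ditems k Fb.length).reverse with hL0
  set M := List.zipWith (negMul N (2 ^ kf)) (NegFFT.dAll N k Fb) (NegFFT.dAll N k Gb) with hM0
  have hwf : NegFFT.AscWF N L M := by
    have := NegFFT.ascWF_ditems N k Fb.length M [] hlL hvL (fun _ _ _ => trivial)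
    rwa [List.append_nil] at this
  have hl : ∀ p ∈ L, p.1 + 4 ≤ n := fun p hp => by
    have := (NegFFT.ditems_gt k Fb.length p (List.mem_reverse.1 hp)).2; omega
  have hA := runs_ascLoop q hN1 hn T hI hCI w hw L hl hwf
  have e1 : ({ w.dframe kf (NegFFT.dAll N k Fb) (NegFFT.dAll N k Gb) (NegFFT.schedFin k []) (NegFFT.histFin k Fb.length []) with
      kn := [], bf := [], bg := [], rr := encBlocks (List.zipWith (negMul N (2 ^ kf)) (NegFFT.dAll N k Fb) (NegFFT.dAll N k Gb)) } : GSlots) = w.aframe L M := by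
    simp [GSlots.dframe, GSlots.aframe, hL0, hM0, NegFFT.schedFin_eq k Fb.length, NegFFT.histFin_eq k Fb.length, show kf - 3 = 0 by omega]
  rw [e1] at hB
  have e2 : w.aframe [] (NegFFT.ascAll N L M) = { w with kn := [], bf := [], bg := [], rr := encBlocks (List.zipWith (NegFFT.negMulRec N k) Fb Gb) } := by
    rw [hL0, hM0, hkf, ← NegFFT.bfRec_eq_plan, NegFFT.bfRec_eq _ _ _ hBG.symm]
    simp [GSlots.aframe, NegFFT.aHist, hkd, hsched, hhist]
  rw [e2] at hA
  refine (hD.seq (hB.seq hA)).of_eq rfl ?_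
  unfold negMulMachineCost; rw [hlF, hL0, ← hkf]; omega

end Com

/-! ## The cost of the multiplier in closed form -/

namespace NegFFT

/-- The data doubles at every descent: `Σ_i B_i 2^{k_i} + B 2^k = 2^{depth} · B 2^k`. [folklore] -/
theorem ditems_sum (k : ℕ) : ∀ (B : ℕ),
    ((ditems k B).map fun p => p.2 * 2 ^ p.1).sum + B * 2 ^ k = 2 ^ (ditems k B).length * (B * 2 ^ k) := by
  induction k using Nat.strong_induction_on with
  | _ k ih =>
    intro B
    by_cases hk : k ≤ 3
    · rw [ditems_of_le hk]; simp
    · rw [ditems_of_gt (by omega), List.map_cons, List.sum_cons, List.length_cons, pow_succ]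
      have h := ih ((k + 1) / 2 + 1) (by omega) (B * 2 ^ (k / 2))
      have e : B * 2 ^ (k / 2) * 2 ^ ((k + 1) / 2 + 1) = 2 * (B * 2 ^ k) := by
        rw [two_pow_split k, pow_succ]; ring
      rw [e] at h
      simp only at h ⊢
      linarith [h]

/-- The depth of the recursion: `2^{depth} ≤ max 1 (2(k-3))`. [folklore] -/
theorem two_pow_depth_le (k : ℕ) : ∀ (B : ℕ), 2 ^ (ditems k B).length ≤ max 1 (2 * (k - 3)) := by
  induction k using Nat.strong_induction_on with
  | _ k ih =>
    intro B
    by_cases hk : k ≤ 3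
    · rw [ditems_of_le hk]; simp
    · rw [ditems_of_gt (by omega), List.length_cons, pow_succ]
      have h := ih ((k + 1) / 2 + 1) (by omega) (B * 2 ^ (k / 2))
      rcases le_max_iff.1 h with h1 | h1
      · have : 2 ^ (ditems ((k + 1) / 2 + 1) (B * 2 ^ (k / 2))).length = 1 := le_antisymm h1 Nat.one_le_two_pow
        rw [this]; exact le_max_of_le_right (by omega)
      · exact le_max_of_le_right (by omega)

/-- The depth is at most `2k` (crudely). [folklore] -/
theorem depth_le (k B : ℕ) : (ditems k B).length ≤ 2 * k := by
  have h1 := two_pow_depth_le k B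
  have h2 : (ditems k B).length < 2 ^ (ditems k B).length := Nat.lt_two_pow_self
  rcases le_max_iff.1 h1 with h | h <;> omega

/-- `2^{depth} ≤ 2k + 1`. [folklore] -/
theorem two_pow_depth_le' (k B : ℕ) : 2 ^ (ditems k B).length ≤ 2 * k + 1 := by
  rcases le_max_iff.1 (two_pow_depth_le k B) with h | h <;> omega

/-- The leaf data is the doubled data: `Bfin · 2^{kfin} = 2^{depth} · B 2^k`. [folklore] -/
theorem Bfin_mul_two_pow (k : ℕ) : ∀ (B : ℕ), Bfin k B * 2 ^ kfin k = 2 ^ (ditems k B).length * (B * 2 ^ k) := by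
  induction k using Nat.strong_induction_on with
  | _ k ih =>
    intro B
    by_cases hk : k ≤ 3
    · rw [Bfin_of_le hk, kfin_of_le hk, ditems_of_le hk]; simp
    · rw [Bfin_of_gt (by omega), kfin_of_gt (by omega), ditems_of_gt (by omega), List.length_cons, pow_succ,
        ih _ (by omega), two_pow_split k, pow_succ]
      ring

/-- Every depth has exponent at most `k`, and the weights `(B_i + 1) 2^{k_i}` sum to at most
`(2k+1)(B+1)2^k`. [folklore] -/
theorem ditems_weight_le (k B : ℕ) :
    ((ditems k B).map fun p => (p.2 + 1) * 2 ^ p.1).sum ≤ (2 * k + 1) * ((B + 1) * 2 ^ k) := by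
  have h1 := ditems_sum k B
  have h2 := two_pow_depth_le' k B
  have h3 := depth_le k B
  have h4 : ((ditems k B).map fun p => (p.2 + 1) * 2 ^ p.1).sum =
      ((ditems k B).map fun p => p.2 * 2 ^ p.1).sum + ((ditems k B).map fun p => 2 ^ p.1).sum := by
    rw [← List.sum_map_add]; exact congrArg List.sum (List.map_congr_left fun p _ => by ring)
  have h5 : ((ditems k B).map fun p => 2 ^ p.1).sum ≤ (ditems k B).length * 2 ^ k := by
    have : ∀ x ∈ (ditems k B).map (fun p => 2 ^ p.1), x ≤ 2 ^ k := by
      intro x hx; rw [List.mem_map] at hx; obtain ⟨p, hp, rfl⟩ := hx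
      exact Nat.pow_le_pow_right (by norm_num) (ditems_gt k B p hp).2
    have hs := List.sum_le_card_nsmul _ _ this
    rwa [List.length_map, smul_eq_mul] at hs
  rw [h4]
  have h6 : ((ditems k B).map fun p => p.2 * 2 ^ p.1).sum ≤ (2 * k) * (B * 2 ^ k) := by
    have : 2 ^ (ditems k B).length * (B * 2 ^ k) ≤ (2 * k + 1) * (B * 2 ^ k) := Nat.mul_le_mul_right _ h2
    rw [add_mul, one_mul] at this; omega
  have h7 : (ditems k B).length * 2 ^ k ≤ 2 * k * 2 ^ k := Nat.mul_le_mul_right _ h3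
  rw [show (2 * k + 1) * ((B + 1) * 2 ^ k) = 2 * k * (B * 2 ^ k) + 2 * k * 2 ^ k + (B + 1) * 2 ^ k by ring]
  have := Nat.add_le_add h6 (h5.trans h7)
  omega

/-- The leaf weight is at most `(2k+2)(B+1)2^k`. [folklore] -/
theorem leaf_weight_le (k B : ℕ) : (Bfin k B + 1) * 2 ^ kfin k ≤ (2 * k + 2) * ((B + 1) * 2 ^ k) := by
  have h1 := Bfin_mul_two_pow k B
  have h2 := two_pow_depth_le' k B
  have h3 : 2 ^ kfin k ≤ 2 ^ k := Nat.pow_le_pow_right (by norm_num) (kfin_le_self k)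
  have h4 : 2 ^ (ditems k B).length * (B * 2 ^ k) ≤ (2 * k + 1) * (B * 2 ^ k) := Nat.mul_le_mul_right _ h2
  rw [add_mul, one_mul, h1, show (2 * k + 2) * ((B + 1) * 2 ^ k) = (2 * k + 1) * (B * 2 ^ k) + 2 ^ k + (B * 2 ^ k + (2 * k + 1) * 2 ^ k) by ring]
  have := Nat.add_le_add h4 h3
  omega

end NegFFT

namespace Com

/-! ### Per-function bounds in terms of `W = (B+1) · 2^k · (n+1)³` -/

/-- `n ≤ (n+1)³`. [folklore] -/
theorem le_cube_succ (n : ℕ) : n ≤ (n + 1) ^ 3 := by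
  have := Nat.le_self_pow (n := 3) (by norm_num) (n + 1); omega


/-- Monotonicity of a triple product. [folklore] -/
theorem mono3 {x y z X Y Z : ℕ} (hx : x ≤ X) (hy : y ≤ Y) (hz : z ≤ Z) : x * y * z ≤ X * Y * Z :=
  Nat.mul_le_mul (Nat.mul_le_mul hx hy) hz

/-- `setParams` costs `O(k (n+1)³)`. [folklore] -/
theorem setParamsCost_le (n k : ℕ) : setParamsCost n k ≤ 953 * ((k + 1) * (n + 1) ^ 3) := by
  unfold setParamsCost
  have h1 := le_cube_succ n
  have h2 : 1 ≤ (n + 1) ^ 3 := Nat.one_le_pow _ _ (by omega)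
  have h3 : n * k ≤ (n + 1) ^ 3 * k := Nat.mul_le_mul_right _ h1
  nlinarith [h1, h2, h3]

/-- The digitize wrapper costs `O(W)`. [folklore] -/
theorem digitCost_le {n m t B k : ℕ} (hmt : m * t = 2 ^ k) (ht : t ≤ 2 ^ k) : digitCost n m t B ≤ 534 * ((B + 1) * 2 ^ k * (n + 1) ^ 3) := by
  set W := (B + 1) * 2 ^ k * (n + 1) ^ 3 with hW
  have hc := le_cube_succ n
  have h1c : 1 ≤ (n + 1) ^ 3 := Nat.one_le_pow _ _ (by omega)
  have h1k : 1 ≤ 2 ^ k := Nat.one_le_two_pow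
  have hB : B ≤ B + 1 := Nat.le_succ B
  have h1 : B * t * m * n ≤ W := by
    calc B * t * m * n = B * (m * t) * n := by ring
      _ ≤ W := mono3 hB hmt.le hc
  have h2 : B * t * n ≤ W := mono3 hB ht hc
  have h3 : B * t * m ≤ W := by
    calc B * t * m = B * (m * t) * 1 := by ring
      _ ≤ W := mono3 hB hmt.le h1c
  have h4 : B * t ≤ W := by
    calc B * t = B * t * 1 := by ring
      _ ≤ W := mono3 hB ht h1c
  have h5 : B * n ≤ W := by
    calc B * n = B * 1 * n := by ring
      _ ≤ W := mono3 hB h1k hc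
  have h6 : B ≤ W := by
    calc B = B * 1 * 1 := by ring
      _ ≤ W := mono3 hB h1k h1c
  have h7 : 1 ≤ W := by
    calc 1 = 1 * 1 * 1 := by ring
      _ ≤ W := mono3 (by omega) h1k h1c
  unfold digitCost digitizeCost digBlockCost
  linarith [h1, h2, h3, h4, h5, h6, h7]

/-- The level bound is `O(W)` for the forward pair cost. [folklore] -/
theorem lvlBound_pairCost_le {n m P B k : ℕ} (hPm : P * m ≤ B * 2 ^ k) (hP : P ≤ B * 2 ^ k) :
    lvlBound (pairCost n m) n m P ≤ 6818 * ((B + 1) * 2 ^ k * (n + 1) ^ 3) := by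
  set W := (B + 1) * 2 ^ k * (n + 1) ^ 3 with hW
  have hc := le_cube_succ n
  have h1c : 1 ≤ (n + 1) ^ 3 := Nat.one_le_pow _ _ (by omega)
  have hD : B * 2 ^ k ≤ (B + 1) * 2 ^ k := Nat.mul_le_mul_right _ (Nat.le_succ B)
  have hPm' : P * m ≤ (B + 1) * 2 ^ k := hPm.trans hD
  have hP' : P ≤ (B + 1) * 2 ^ k := hP.trans hD
  have h1 : P * m * (n + 1) ^ 3 ≤ W := Nat.mul_le_mul_right _ hPm'
  have h2 : P * (n + 1) ^ 3 ≤ W := Nat.mul_le_mul_right _ hP'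
  have h3 : P * m * n ≤ W := Nat.mul_le_mul hPm' hc
  have h4 : P * n ≤ W := Nat.mul_le_mul hP' hc
  have h5 : P ≤ W := by
    calc P = P * 1 := by ring
      _ ≤ W := Nat.mul_le_mul hP' h1c
  have h6 : 1 ≤ W := by
    calc 1 = 1 * 1 * 1 := by ring
      _ ≤ W := mono3 (by omega) Nat.one_le_two_pow h1c
  unfold lvlBound pairCost
  linarith [h1, h2, h3, h4, h5, h6]

/-- The level bound is `O(W)` for the inverse pair cost. [folklore] -/
theorem lvlBound_pairInvCost_le {n m P B k : ℕ} (hPm : P * m ≤ B * 2 ^ k) (hP : P ≤ B * 2 ^ k) :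
    lvlBound (pairInvCost n m) n m P ≤ 11218 * ((B + 1) * 2 ^ k * (n + 1) ^ 3) := by
  set W := (B + 1) * 2 ^ k * (n + 1) ^ 3 with hW
  have hc := le_cube_succ n
  have h1c : 1 ≤ (n + 1) ^ 3 := Nat.one_le_pow _ _ (by omega)
  have hD : B * 2 ^ k ≤ (B + 1) * 2 ^ k := Nat.mul_le_mul_right _ (Nat.le_succ B)
  have hPm' : P * m ≤ (B + 1) * 2 ^ k := hPm.trans hD
  have hP' : P ≤ (B + 1) * 2 ^ k := hP.trans hD
  have h1 : P * m * (n + 1) ^ 3 ≤ W := Nat.mul_le_mul_right _ hPm'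
  have h2 : P * (n + 1) ^ 3 ≤ W := Nat.mul_le_mul_right _ hP'
  have h3 : P * m * n ≤ W := Nat.mul_le_mul hPm' hc
  have h4 : P * n ≤ W := Nat.mul_le_mul hP' hc
  have h5 : P ≤ W := by
    calc P = P * 1 := by ring
      _ ≤ W := Nat.mul_le_mul hP' h1c
  have h6 : 1 ≤ W := by
    calc 1 = 1 * 1 * 1 := by ring
      _ ≤ W := mono3 (by omega) Nat.one_le_two_pow h1c
  unfold lvlBound pairInvCost
  linarith [h1, h2, h3, h4, h5, h6]

/-- The level-loop parameters: `P = B 2^{lv-1}` with `P m ≤ B 2^k`, `P ≤ B 2^k`. [folklore] -/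
theorem levelP_le (k B : ℕ) : B * 2 ^ (k / 2 - 1) * 2 ^ ((k + 1) / 2) ≤ B * 2 ^ k ∧ B * 2 ^ (k / 2 - 1) ≤ B * 2 ^ k := by
  refine ⟨?_, Nat.mul_le_mul_left _ (Nat.pow_le_pow_right (by norm_num) (by omega))⟩
  rw [mul_assoc, ← pow_add]; exact Nat.mul_le_mul_left _ (Nat.pow_le_pow_right (by norm_num) (by omega))

/-- The descent step costs `O(k W)`. [folklore] -/
theorem descStepCost_le (n k B : ℕ) : descStepCost n k B ≤ 15940 * ((k + 1) * ((B + 1) * 2 ^ k * (n + 1) ^ 3)) := by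
  set W := (B + 1) * 2 ^ k * (n + 1) ^ 3 with hW
  set m := 2 ^ ((k + 1) / 2) with hm
  set t := 2 ^ (k / 2) with ht
  set P := B * 2 ^ (k / 2 - 1) with hP0
  have hmt : m * t = 2 ^ k := by rw [hm, ht]; exact (NegFFT.two_pow_split k).symm
  have htk : t ≤ 2 ^ k := by rw [ht]; exact Nat.pow_le_pow_right (by norm_num) (by omega)
  obtain ⟨hPm, hP⟩ := levelP_le k B
  rw [← hm, ← hP0] at hPm; rw [← hP0] at hP
  have hc := le_cube_succ n
  have h1c : 1 ≤ (n + 1) ^ 3 := Nat.one_le_pow _ _ (by omega)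
  have h1W : 1 ≤ W := by
    calc 1 = 1 * 1 * 1 := by ring
      _ ≤ W := mono3 (by omega) Nat.one_le_two_pow h1c
  have hcW : (n + 1) ^ 3 ≤ W := by
    calc (n + 1) ^ 3 = 1 * 1 * (n + 1) ^ 3 := by ring
      _ ≤ W := mono3 (by omega) Nat.one_le_two_pow le_rfl
  have hD : B * 2 ^ k ≤ (B + 1) * 2 ^ k := Nat.mul_le_mul_right _ (Nat.le_succ B)
  have hsp := setParamsCost_le n k
  have hdg := digitCost_le (n := n) (B := B) hmt htk
  have hlb := lvlBound_pairCost_le (n := n) hPm hP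
  have hPn : P * n ≤ W := Nat.mul_le_mul (hP.trans hD) hc
  have hPW : P ≤ W := by
    calc P = P * 1 := by ring
      _ ≤ W := Nat.mul_le_mul (hP.trans hD) h1c
  have hli : lvIterCost n m P ≤ 13731 * W := by unfold lvIterCost; linarith [hlb, hPn, hPW, hcW, h1W]
  have hBt : B * t ≤ (B + 1) * 2 ^ k := Nat.mul_le_mul (Nat.le_succ B) htk
  have hBtn : B * t * n ≤ W := Nat.mul_le_mul hBt hc
  have hBtW : B * t ≤ W := by
    calc B * t = B * t * 1 := by ring
      _ ≤ W := Nat.mul_le_mul hBt h1c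
  have hdc : descCCost n k B ≤ 117 * W := by unfold descCCost; rw [← ht]; linarith [hBtn, hBtW, hcW, h1W]
  have hda : descACost n k B ≤ 1133 * W + 953 * ((k + 1) * (n + 1) ^ 3) := by
    unfold descACost; rw [← hm, ← ht]; linarith [hsp, hdg, hc, hcW, h1W]
  have hkc : (k + 1) * (n + 1) ^ 3 ≤ (k + 1) * W := Nat.mul_le_mul_left _ hcW
  have hloop : k / 2 * (lvIterCost n m P + 2) + 1 ≤ k * (13733 * W) + W := by
    have : k / 2 * (lvIterCost n m P + 2) ≤ k * (13733 * W) := Nat.mul_le_mul (Nat.div_le_self k 2) (by linarith [hli, h1W])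
    omega
  unfold descStepCost; rw [← hm, ← hP0]
  linarith [hda, hdc, hloop, hkc, h1W]

/-- The overlap-add stage costs `O(W)`. [folklore] -/
theorem oaRRCost_le {n m t B k : ℕ} (hmt : m * t = 2 ^ k) (hm : m ≤ 2 ^ k) (ht : t ≤ 2 ^ k) :
    oaRRCost n m t B ≤ 2916 * ((B + 1) * 2 ^ k * (n + 1) ^ 3) := by
  set W := (B + 1) * 2 ^ k * (n + 1) ^ 3 with hW
  have hc := le_cube_succ n
  have h1c : 1 ≤ (n + 1) ^ 3 := Nat.one_le_pow _ _ (by omega)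
  have h1k : 1 ≤ 2 ^ k := Nat.one_le_two_pow
  have hB : B ≤ B + 1 := Nat.le_succ B
  have h1 : B * t * m * (n + 1) ^ 3 ≤ W := by
    calc B * t * m * (n + 1) ^ 3 = B * (m * t) * (n + 1) ^ 3 := by ring
      _ ≤ W := mono3 hB hmt.le le_rfl
  have h2 : B * m * (n + 1) ^ 3 ≤ W := mono3 hB hm le_rfl
  have h3 : B * t * m * n ≤ W := by
    calc B * t * m * n = B * (m * t) * n := by ring
      _ ≤ W := mono3 hB hmt.le hc
  have h4 : B * m * n ≤ W := mono3 hB hm hc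
  have h5 : B * t * n ≤ W := mono3 hB ht hc
  have h6 : B * n ≤ W := by
    calc B * n = B * 1 * n := by ring
      _ ≤ W := mono3 hB h1k hc
  have h7 : B * t * m ≤ W := by
    calc B * t * m = B * (m * t) * 1 := by ring
      _ ≤ W := mono3 hB hmt.le h1c
  have h8 : B * m ≤ W := by
    calc B * m = B * m * 1 := by ring
      _ ≤ W := mono3 hB hm h1c
  have h9 : B * t ≤ W := by
    calc B * t = B * t * 1 := by ring
      _ ≤ W := mono3 hB ht h1c
  have h10 : B ≤ W := by
    calc B = B * 1 * 1 := by ring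
      _ ≤ W := mono3 hB h1k h1c
  have h11 : 1 ≤ W := by
    calc 1 = 1 * 1 * 1 := by ring
      _ ≤ W := mono3 (by omega) h1k h1c
  unfold oaRRCost revPassCost oaPassCost oaInstCost oaFirstCost oaStepCost oaLastCost oaSplitCost vArithCost
  linarith [h1, h2, h3, h4, h5, h6, h7, h8, h9, h10, h11]

/-- The ascent step costs `O(k W)`. [folklore] -/
theorem ascStepCost_le (n k B : ℕ) : ascStepCost n k B ≤ 12300 * ((k + 1) * ((B + 1) * 2 ^ k * (n + 1) ^ 3)) := by
  set W := (B + 1) * 2 ^ k * (n + 1) ^ 3 with hW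
  set m := 2 ^ ((k + 1) / 2) with hm
  set t := 2 ^ (k / 2) with ht
  set P := B * 2 ^ (k / 2 - 1) with hP0
  have hmt : m * t = 2 ^ k := by rw [hm, ht]; exact (NegFFT.two_pow_split k).symm
  have htk : t ≤ 2 ^ k := by rw [ht]; exact Nat.pow_le_pow_right (by norm_num) (by omega)
  have hmk : m ≤ 2 ^ k := by rw [hm]; exact Nat.pow_le_pow_right (by norm_num) (by omega)
  obtain ⟨hPm, hP⟩ := levelP_le k B
  rw [← hm, ← hP0] at hPm; rw [← hP0] at hP
  have hc := le_cube_succ n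
  have h1c : 1 ≤ (n + 1) ^ 3 := Nat.one_le_pow _ _ (by omega)
  have h1W : 1 ≤ W := by
    calc 1 = 1 * 1 * 1 := by ring
      _ ≤ W := mono3 (by omega) Nat.one_le_two_pow h1c
  have hcW : (n + 1) ^ 3 ≤ W := by
    calc (n + 1) ^ 3 = 1 * 1 * (n + 1) ^ 3 := by ring
      _ ≤ W := mono3 (by omega) Nat.one_le_two_pow le_rfl
  have hsp := setParamsCost_le n k
  have hoa := oaRRCost_le (n := n) (B := B) hmt hmk htk
  have hlb := lvlBound_pairInvCost_le (n := n) hPm hP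
  have hli : ascIterCost n m P ≤ 11231 * W := by unfold ascIterCost; linarith [hlb, hcW, h1W]
  have haa : ascACost n k ≤ 37 * W + 953 * ((k + 1) * (n + 1) ^ 3) := by unfold ascACost; linarith [hsp, hc, hcW, h1W]
  have hac : ascCCost n k B ≤ 2978 * W := by unfold ascCCost; rw [← hm, ← ht]; linarith [hoa, hcW]
  have hkc : (k + 1) * (n + 1) ^ 3 ≤ (k + 1) * W := Nat.mul_le_mul_left _ hcW
  have hloop : k / 2 * (ascIterCost n m P + 2) + 1 ≤ k * (11233 * W) + W := by
    have : k / 2 * (ascIterCost n m P + 2) ≤ k * (11233 * W) := Nat.mul_le_mul (Nat.div_le_self k 2) (by linarith [hli, h1W])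
    omega
  unfold ascStepCost; rw [← hm, ← hP0]
  linarith [haa, hac, hloop, hkc, h1W]

/-- The leaves cost `O(W_leaf)` (block length `2^{kf} ≤ 8`). [folklore] -/
theorem baseAllCost_le {n kf Bf : ℕ} (hkf : kf ≤ 3) : baseAllCost n kf Bf ≤ 21604 * ((Bf + 1) * 2 ^ kf * (n + 1) ^ 3) := by
  set W := (Bf + 1) * 2 ^ kf * (n + 1) ^ 3 with hW
  set L := 2 ^ kf with hL
  have hL8 : L ≤ 8 := by rw [hL]; exact (Nat.pow_le_pow_right (by norm_num) hkf).trans (by norm_num)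
  have hL1 : 1 ≤ L := by rw [hL]; exact Nat.one_le_two_pow
  have hc := le_cube_succ n
  have h1c : 1 ≤ (n + 1) ^ 3 := Nat.one_le_pow _ _ (by omega)
  have hB : Bf ≤ Bf + 1 := Nat.le_succ Bf
  have h1 : Bf * L * L * (n + 1) ^ 3 ≤ 8 * W := by
    calc Bf * L * L * (n + 1) ^ 3 = L * (Bf * L * (n + 1) ^ 3) := by ring
      _ ≤ 8 * W := Nat.mul_le_mul hL8 (mono3 hB le_rfl le_rfl)
  have h2 : Bf * L * (n + 1) ^ 3 ≤ W := mono3 hB le_rfl le_rfl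
  have h3 : Bf * (n + 1) ^ 3 ≤ W := by
    calc Bf * (n + 1) ^ 3 = Bf * 1 * (n + 1) ^ 3 := by ring
      _ ≤ W := mono3 hB hL1 le_rfl
  have h4 : Bf * L * n ≤ W := mono3 hB le_rfl hc
  have h5 : Bf * n ≤ W := by
    calc Bf * n = Bf * 1 * n := by ring
      _ ≤ W := mono3 hB hL1 hc
  have h6 : Bf ≤ W := by
    calc Bf = Bf * 1 * 1 := by ring
      _ ≤ W := mono3 hB hL1 h1c
  have h7 : n ≤ W := by
    calc n = 1 * 1 * n := by ring
      _ ≤ W := mono3 (by omega) hL1 hc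
  have h8 : (n + 1) ^ 3 ≤ W := by
    calc (n + 1) ^ 3 = 1 * 1 * (n + 1) ^ 3 := by ring
      _ ≤ W := mono3 (by omega) hL1 le_rfl
  have h9 : 1 ≤ W := by
    calc 1 = 1 * 1 * 1 := by ring
      _ ≤ W := mono3 (by omega) hL1 h1c
  have h10 : n * kf ≤ 3 * W := by
    calc n * kf ≤ W * 3 := Nat.mul_le_mul h7 hkf
      _ = 3 * W := by ring
  have h11 : kf ≤ 3 * W := hkf.trans (by omega)
  unfold baseAllCost baseStepCost basePassCost baseBodyCost negMulCost
  rw [← hL]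
  linarith [h1, h2, h3, h4, h5, h6, h7, h8, h9, h10, h11]

/-- Summing a pointwise-bounded map. [folklore] -/
theorem sum_map_le_of_le {α : Type*} (l : List α) (f g : α → ℕ) (h : ∀ a ∈ l, f a ≤ g a) : (l.map f).sum ≤ (l.map g).sum := by
  induction l with
  | nil => simp
  | cons a l ih =>
    simp only [List.map_cons, List.sum_cons]
    exact Nat.add_le_add (h a (by simp)) (ih fun b hb => h b (by simp [hb]))

/-- **The multiplier runs in `O(k² · (B+1) 2^k · (n+1)³)` steps**: quasi-linear in the data size
`B · 2^k` (numerals of `≤ n` bits). [folklore] -/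
theorem negMulMachineCost_le (n k B : ℕ) :
    negMulMachineCost n k B ≤ 100000 * ((k + 1) ^ 2 * ((B + 1) * 2 ^ k * (n + 1) ^ 3)) := by
  set W := (B + 1) * 2 ^ k * (n + 1) ^ 3 with hW
  set c := (n + 1) ^ 3 with hc3
  set d := NegFFT.ditems k B with hd
  have h1c : 1 ≤ c := Nat.one_le_pow _ _ (by omega)
  have h1W : 1 ≤ W := by
    calc 1 = 1 * 1 * 1 := by ring
      _ ≤ W := mono3 (by omega) Nat.one_le_two_pow h1c
  have hcW : c ≤ W := by
    calc c = 1 * 1 * c := by ring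
      _ ≤ W := mono3 (by omega) Nat.one_le_two_pow le_rfl
  -- the loops, depth by depth
  have hper : ∀ p ∈ d, descBodyCost n p + ascStepCost n p.1 p.2 ≤ 28291 * ((k + 1) * ((p.2 + 1) * 2 ^ p.1 * c)) := by
    intro p hp
    have hpk : p.1 ≤ k := (NegFFT.ditems_gt k B p (by rw [← hd]; exact hp)).2
    have h1 := descStepCost_le n p.1 p.2
    have h2 := ascStepCost_le n p.1 p.2
    have h3 : (p.1 + 1) * ((p.2 + 1) * 2 ^ p.1 * c) ≤ (k + 1) * ((p.2 + 1) * 2 ^ p.1 * c) := Nat.mul_le_mul_right _ (by omega)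
    have h4 : c ≤ (p.2 + 1) * 2 ^ p.1 * c := by
      calc c = 1 * 1 * c := by ring
        _ ≤ _ := mono3 (by omega) Nat.one_le_two_pow le_rfl
    have h5 : (p.2 + 1) * 2 ^ p.1 * c ≤ (k + 1) * ((p.2 + 1) * 2 ^ p.1 * c) := Nat.le_mul_of_pos_left _ (by omega)
    unfold descBodyCost; rw [← hc3] at h1 h2 ⊢
    linarith [h1, h2, h3, h4, h5]
  have hsum : (d.map fun p => descBodyCost n p + ascStepCost n p.1 p.2).sum ≤ 28291 * ((k + 1) * ((2 * k + 1) * W)) := by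
    have h1 := sum_map_le_of_le d _ _ hper
    have h2 : (d.map fun p => 28291 * ((k + 1) * ((p.2 + 1) * 2 ^ p.1 * c))).sum = 28291 * ((k + 1) * ((d.map fun p => (p.2 + 1) * 2 ^ p.1).sum * c)) := by
      rw [List.sum_map_mul_left, List.sum_map_mul_left, List.sum_map_mul_right]
    have h3 := NegFFT.ditems_weight_le k B
    rw [← hd] at h3
    have h4 : (d.map fun p => (p.2 + 1) * 2 ^ p.1).sum * c ≤ (2 * k + 1) * W := by
      rw [hW, ← mul_assoc (2 * k + 1)]; exact Nat.mul_le_mul_right _ h3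
    rw [h2] at h1
    exact h1.trans (Nat.mul_le_mul_left _ (Nat.mul_le_mul_left _ h4))
  have hsplit : (d.map (descBodyCost n)).sum + (d.reverse.map fun p => ascStepCost n p.1 p.2).sum =
      (d.map fun p => descBodyCost n p + ascStepCost n p.1 p.2).sum := by
    rw [List.map_reverse, List.sum_reverse, ← List.sum_map_add]
  have hlen := NegFFT.depth_le k B
  rw [← hd] at hlen
  -- the leaves
  have hbase := baseAllCost_le (n := n) (Bf := NegFFT.Bfin k B) (NegFFT.kfin_le_three k)
  have hleaf := NegFFT.leaf_weight_le k B
  have hbase' : baseAllCost n (NegFFT.kfin k) (NegFFT.Bfin k B) ≤ 21604 * ((2 * k + 2) * W) := by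
    refine hbase.trans (Nat.mul_le_mul_left _ ?_)
    rw [hW, ← mul_assoc (2 * k + 2)]; exact Nat.mul_le_mul_right _ hleaf
  have hkW : k ≤ k * W := Nat.le_mul_of_pos_right _ h1W
  unfold negMulMachineCost descLoopCost ascLoopCost
  rw [← hd, ← hc3, List.length_reverse]
  nlinarith [hsum, hsplit, hbase', hcW, h1W, hlen, hkW]

end Com

end Literature.Computability.Complexity
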